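import Summits.QuantumFields.BalabanUV.Gaps.D1PinnedResponseTowers
import Summits.QuantumFields.BalabanUV.Gaps.D1PinnedSecondOrderModular
import Summits.QuantumFields.BalabanUV.Gaps.D1PinnedSecondOrderUniversal
import Summits.QuantumFields.BalabanUV.Gaps.D1PinnedTableResponseUniversal
import Summits.QuantumFields.BalabanUV.Gaps.D1PinnedColourLineReadings
import Summits.QuantumFields.BalabanUV.Gaps.D1PinnedTableSpanDecision

/-!
# D1 (pinned family) — 382 MEMBERS DECIDE (D1) ON THE WHOLE PINNED FAMILY (fixed root, numeral, channel), HYPOTHESIS-FREE at the pin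

Census row 80 of `HOME/g1/RESIDUE.md` (the «382 members» recipe, assembled; file 6 of the item-(v) package).  **`d1Drift_of_members382`**: if the drift criterion (D1) holds
(1) at the 125 colour members `(cE₀ + i, cVH₀ + j, cΛ₀ + k; cB = 0; Tc = 0)`, `i,j,k ∈ {0..4}` (⟹ at every colour triple with `cB = 0, Tc = 0`, `D1PinnedColourLineReadings.d1Drift_of_grid125`),
(2) at the ONE border member `(0⃗; cB = 1; Tc = 0)`, and (3) at the 256 table members `(0⃗; cB = 0; Tc = b i)` for Mathlib's `Module.finBasis` `b` of the position tables
(⟹ at every table, `D1PinnedTableSpanDecision.d1Drift_table_of_finBasis`), then (D1) holds at EVERY member `(c⃗; cB; Tc)` of the β-lead's pinned family with the same root —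
by the normal form `lim β⁰(r,c⃗;cB,Tc) = lim β⁰(r,c⃗;0,0) + cB·(lim β⁰(r,0⃗;1,0) − lim β⁰(r,0⃗;0,0)) + (lim β⁰(r,0⃗;0,Tc) − lim β⁰(r,0⃗;0,0))` (GEN 10's modular law
`D1PinnedSecondOrderModular`, the cB-affinity `D1PinnedResponseTowers.lim_border_affine`, the universality of the border slope `D1PinnedSecondOrderUniversal` and of the table response
`D1PinnedTableResponseUniversal`, combined inline as in the capstone `D1PinnedSecondOrderNormalForm.lim_normalForm` (p373481)).  Conversely, in the capstone's trichotomy this is case C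
(`σ(r) = 0 ∧ λ ≡ 0`) together with `γ(r) + φ ≡ stepBal N Lc`.  CONTENT: [folklore]; 0 def, 0 sorry.

Provenance: cell pub-balaban-gaps, seat g1-p1 GEN 12 (prover-pub-balaban-gaps-g1-p1-g12-0), 2026-08-24.  HONEST FRAMING: [folklore] kernel algebra BY NAME over tree theorems;
NOTHING of Bałaban's asserted ([Balaban1987RG1] Thm 2 is UNPROVED IN PRINT); NO coefficient computed or signed; which members satisfy (D1) is print's UNCOMPUTED data; binder
(D1) of B12 Thm 2 at the β-lead's pinned literal is NOT discharged; NOT `BetaPertH`, NOT continuum, NOT Clay.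
-/

noncomputable section

open Finset
open scoped BigOperators
open Literature.MathematicalPhysics.QuantumFieldTheory Balaban1983to89 Balaban1983to89.Beta
open OneStepKernelFamily (TbalOf D1Drift)
open AffineAveraging (box toSite)
open RateCertificate (CauchyRate)
open Summit.QuantumFields.BalabanUV.Beta.MixedJetTablesPlug (JsBalAn1)
open Summit.QuantumFields.BalabanUV.Beta.GAN24.StencilSlotOfE3 (one_le_of_two_le)
open Summit.QuantumFields.BalabanUV.Gaps.CapTailPinnedLimitSign (d1Drift_pinned_iff_lim_eq)
open Summit.QuantumFields.BalabanUV.Gaps.D1PinnedResponseTowers (lim_border_affine)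
open Summit.QuantumFields.BalabanUV.Gaps.D1PinnedSecondOrderModular (lim_JsBalAn1_secondOrder_modular)
open Summit.QuantumFields.BalabanUV.Gaps.D1PinnedSecondOrderUniversal (lim_JsBalAn1_response_universal)
open Summit.QuantumFields.BalabanUV.Gaps.D1PinnedTableResponseUniversal (lim_JsBalAn1_tableResponse_universal)
open Summit.QuantumFields.BalabanUV.Gaps.D1PinnedColourLineReadings (d1Drift_of_grid125)
open Summit.QuantumFields.BalabanUV.Gaps.D1PinnedTableSpanDecision (d1Drift_table_of_finBasis)

namespace Summit.QuantumFields.BalabanUV.Gaps.D1PinnedFiniteDecision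

variable {Lc : ℕ} [NeZero Lc] {r : Fin (3 + 1) → ℕ}

/-- [folklore] **382 MEMBERS DECIDE (D1) ON THE WHOLE PINNED FAMILY, HYPOTHESIS-FREE** (fixed root `r`, numeral `N`, channel `(μ,ν)`): (D1) at the 125 unit-grid colour members with
`cB = 0, Tc = 0`, at the border member `(0⃗; 1; 0)` and at the 256 `Module.finBasis` table members `(0⃗; 0; b i)` ⟹ (D1) at every `(c⃗; cB; Tc)`. -/
theorem d1Drift_of_members382 (hLc : 2 ≤ Lc) (hr : r ∈ box (3 + 1) Lc) (cE₀ cVH₀ cΛ₀ : ℝ) (μ ν : Fin 4) (N : ℝ)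
    (hgrid : ∀ i j k : ℕ, i ≤ 4 → j ≤ 4 → k ≤ 4 →
      D1Drift Lc (JsBalAn1 (one_le_of_two_le hLc) hr (cE₀ + i) (cVH₀ + j) (cΛ₀ + k) ((Lc : ℝ) ^ (2 * (3 + 1))) 0 0) N μ ν)
    (hborder : D1Drift Lc (JsBalAn1 (one_le_of_two_le hLc) hr 0 0 0 ((Lc : ℝ) ^ (2 * (3 + 1))) 1 0) N μ ν)
    (htab : ∀ i, D1Drift Lc (JsBalAn1 (one_le_of_two_le hLc) hr 0 0 0 ((Lc : ℝ) ^ (2 * (3 + 1))) 0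
      (Module.finBasis ℝ (Fin 4 → Fin 4 → Fin 4 → Fin 4 → ℝ) i)) N μ ν)
    (cE cVH cΛ cB : ℝ) (Tc : Fin 4 → Fin 4 → Fin 4 → Fin 4 → ℝ) :
    D1Drift Lc (JsBalAn1 (one_le_of_two_le hLc) hr cE cVH cΛ ((Lc : ℝ) ^ (2 * (3 + 1))) cB Tc) N μ ν := by
  -- (1) every colour triple at `cB = 0, Tc = 0`
  have hcol : ∀ a b c : ℝ, CauchyRate.lim (fun j => B12Beta.secondMoment (TbalOf Lc (JsBalAn1 (one_le_of_two_le hLc) hr a b c ((Lc : ℝ) ^ (2 * (3 + 1))) 0 0) j) μ ν) =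
      B12Normalization.stepBal N Lc :=
    fun a b c => (d1Drift_pinned_iff_lim_eq hLc hr a b c 0 0 μ ν N).mp (d1Drift_of_grid125 hLc hr cE₀ cVH₀ cΛ₀ 0 0 μ ν N hgrid a b c)
  -- (2) the border member
  have hb := (d1Drift_pinned_iff_lim_eq hLc hr 0 0 0 1 0 μ ν N).mp hborder
  -- (3) every table at `c⃗ = 0⃗, cB = 0`
  have htabs : CauchyRate.lim (fun j => B12Beta.secondMoment (TbalOf Lc (JsBalAn1 (one_le_of_two_le hLc) hr 0 0 0 ((Lc : ℝ) ^ (2 * (3 + 1))) 0 Tc) j) μ ν) =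
      B12Normalization.stepBal N Lc :=
    (d1Drift_pinned_iff_lim_eq hLc hr 0 0 0 0 Tc μ ν N).mp
      (d1Drift_table_of_finBasis hLc hr 0 0 0 0 μ ν N (d1Drift_of_grid125 hLc hr cE₀ cVH₀ cΛ₀ 0 0 μ ν N hgrid 0 0 0) htab Tc)
  -- the normal form at `(c⃗; cB; Tc)` with reference root `r` (as in the capstone's `lim_normalForm`)
  have hmod := lim_JsBalAn1_secondOrder_modular hLc hr cE cVH cΛ cB Tc μ ν
  have haff := lim_border_affine hLc hr cE cVH cΛ cB 0 μ ν
  have hσ := lim_JsBalAn1_response_universal hLc hr cE cVH cΛ 0 0 0 1 0 μ ν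
  have hlam := lim_JsBalAn1_tableResponse_universal hLc hr hr cE cVH cΛ 0 0 0 0 0 Tc μ ν
  have hA := hcol cE cVH cΛ
  have hD := hcol 0 0 0
  rw [d1Drift_pinned_iff_lim_eq hLc hr]
  linear_combination hmod + haff + cB * hσ + hlam + hA + cB * hb - cB * hD + htabs - hD

end Summit.QuantumFields.BalabanUV.Gaps.D1PinnedFiniteDecision

end
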